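import Summits.BirchSwinnertonDyer.Rank1Residual.Additive.RamifiedOrdinaryLineUniqueAbstract
import Summits.BirchSwinnertonDyer.Rank1Residual.Additive.RamifiedOrdinaryLineUniqueClasses
import Summits.BirchSwinnertonDyer.Rank1Residual.AdditivePotMult.PotMultTateLineAllLevel
import Summits.BirchSwinnertonDyer.Rank1Residual.AdditivePotMult.RamifiedOrdinaryLinePotMult
import HarnessLib

/-!
# Uniqueness of the ramified ordinary line on the (M) rows — X4(M) / X3♯(M) / `PotMult W p` — modulo
# the PUBLISHED Tate uniformisation A40/A41, and the ∃-line form of `RamifiedLineKummerEqAt` there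
# (cell `b2b-bsdres`, lane CLASS-CLOSURE, seat cc-typer-2; team n1011 R5-47 (b): cc-typer-2 = owner of
# `IsRamifiedOrdinaryLine` uniqueness; the Tate-line inertia action at all levels is p07's p267699)

HONEST FRAMING (cell `b2b-bsdres`, run/shared/lean/b2b/bsd-rank1-residual/, verbatim in every file):
the goal of the cell is to DELETE the COMBINATION-SHAPED residual classes of the Birch–Swinnerton-Dyer
formula for ALL analytic-rank `≤ 1` elliptic curves over `ℚ` — assembled STRICTLY from published
theorems — so that the rank-`≤ 1` remainder becomes exactly the CONSTRUCTION-SHAPED classes, which are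
TYPED (missing-input `Prop`s), NOT attempted. This is not "finishing BSD". Team n1011 / lane
CLASS-CLOSURE: research routes; no claim beyond stated classes; census output = EVIDENCE, never a
Literature fact; RESIDUAL-MAP marks UNCHANGED; nothing is booked by this file. Theorems only: NO
definition, NO named fact, NO conjecture node.

WHAT.
* §1 DATUM-LEVEL TRANSPORT: `LocalDatum.plus_eq_map_of_isRamifiedOrdinaryLine_of_inertia_scalar` — if a
  datum `N` of `V[p^∞]` is `p`-divisible with `#(N.plus ∩ V[p^∞][p]) = p` and some local inertia
  element acts on `N.plus` as a natural scalar `u > 1`, then for ANY sign-equivariant additive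
  `e : V[p^∞] ≃+ W[p^∞]` every ramified ordinary line `L` of `W` at `v` has `L.plus = e(N.plus)`
  (`RamifiedOrdinaryLineUniqueAbstract` + the square trick of `RamifiedOrdinaryLineUnique` §3); hence
  any two ramified ordinary lines of `W` coincide.
* §2 THE TATE LINE: `exists_tateLine_inertia_scalar` — `V` globally minimal, multiplicative at the odd
  `p`, `v ∋ p`, granted A40/A41 (`Silverman1994_thmV53[_corV54]_tateUniformisation`): a local datum `N`
  (p07's Tate line package `exists_tateDatum_package_all`) with (a) divisible, (b) `#C[p] = p`,
  (c) an inertia element acting on `C` as `1 + p` (clause (vii) of the package at `k = 1 + p`, with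
  `χ_p(I_{ℚ_v}) = ℤ_p^×`).
* §3 MODELS AND CLASSES: `eq_of_isRamifiedOrdinaryLine_of_mult_model_twist` (`W = C • V^{(d)}`, `V`
  multiplicative at `p`), **`PotMult.eq_of_isRamifiedOrdinaryLine`**, **`ClassX4M.eq_of_isRamifiedOrdinaryLine`**
  (every odd `p`), **`ClassX3M.eq_of_isRamifiedOrdinaryLine`** — mod A40/A41, any two ramified ordinary
  lines at `v ∋ p` are EQUAL; with p07's `ClassX4M/ClassX3M.exists_isRamifiedOrdinaryLine` the line is
  `∃!`. Adapters **`PotMult.ramifiedLineKummerEqAt_of_exists`**, `ClassX4M.…`, `ClassX3M.…`: ONE line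
  with the Greenberg = Kummer equality per `(κ, v)` (team n1011 row T-RD-M, p07's assembly
  `PotMultGreenbergKummerIdentification`) ⟹ the ∀-line binder `Additive.RamifiedLineKummerEqAt W p`.

References: Greenberg LNM 1716 §2 pp. 63, 74–76 [GreenbergLNM1716]; Greenberg–Vatsal 2000 §2 pp. 14–16,
26 [GreenbergVatsal2000]; Silverman *ATAEC* V.3.1, V.5.3, V.5.4 [SilvermanATAEC1994].
-/

noncomputable section

open scoped Classical NumberField AddSubgroup

open NumberField IsDedekindDomain Field WeierstrassCurve
  Literature.NumberTheory.GaloisRepresentations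
  Literature.NumberTheory.EllipticCurves
  Literature.NumberTheory.EllipticCurves.Rank1Residual
  Literature.NumberTheory.EllipticCurves.GreenbergSelmer
  Literature.NumberTheory.EllipticCurves.EmertonPollackWeston2006
  IsDedekindDomain.HeightOneSpectrum
  Summit.BirchSwinnertonDyer.Rank1Residual.X2
  Summit.BirchSwinnertonDyer.Rank1Residual.Additive
open WeierstrassCurve (minimalDiscriminantInt integralModelInt)

universe u

/-! ## §1. Datum-level transport -/

namespace Literature.NumberTheory.EllipticCurves.GreenbergSelmer.LocalDatum

variable {V : WeierstrassCurve ℚ} [V.IsElliptic] {p : ℕ} [hp : Fact p.Prime]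
  {v : HeightOneSpectrum (𝓞 ℚ)} (N : LocalDatum ℚ ↥(V.geomPrimaryTorsion p) v)

/-- **Every ramified ordinary line of a signed transport is the transport of the datum.** `N` a local
datum of `V[p^∞]` at `v` with (a) `p`-divisible, (b) `#(N.plus ∩ V[p^∞][p]) = p`, (c) a local inertia
element acting on `N.plus` as a natural scalar `u > 1`; `e : V[p^∞] ≃+ W[p^∞]` additive and
sign-equivariant at every `σ ∈ Γ_ℚ`. Then every `L` with `IsRamifiedOrdinaryLine W p L` at `v` has
`L.plus = e(N.plus)` (`e⁻¹(L.plus)` is `p`-divisible, proper, and `σ^{2n}` acts trivially on its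
quotient). [cite: GreenbergVatsal2000, §2 p. 26] [cite: GreenbergLNM1716, §2 p. 63] -/
theorem plus_eq_map_of_isRamifiedOrdinaryLine_of_inertia_scalar
    (hCdiv : ∀ c ∈ N.plus, ∃ c' ∈ N.plus, p • c' = c)
    (hCp : Nat.card ↥(N.plus ⊓ (↥(V.geomPrimaryTorsion p))[(p : ℤ)]) = p)
    (hσ : ∃ σ ∈ absInertia (v.adicCompletion ℚ), ∃ u : ℕ, 1 < u ∧
      ∀ m ∈ N.plus, absGaloisRestrict ℚ (v.adicCompletion ℚ) σ • m = u • m)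
    {W : WeierstrassCurve ℚ} (e : ↥(V.geomPrimaryTorsion p) ≃+ ↥(W.geomPrimaryTorsion p))
    (he : ∀ σ : absoluteGaloisGroup ℚ, (∀ m, e (σ • m) = σ • e m) ∨ (∀ m, e (σ • m) = -(σ • e m)))
    (L : LocalDatum ℚ ↥(W.geomPrimaryTorsion p) v) (hL : IsRamifiedOrdinaryLine W p L) :
    L.plus = N.plus.map e.toAddMonoidHom := by
  obtain ⟨hLdiv, hLtop, -, ⟨n, hnpos, hLn⟩, -⟩ := hL
  -- squares are equivariant
  have hsq : ∀ (g : absoluteGaloisGroup ℚ) (m : ↥(V.geomPrimaryTorsion p)),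
      e (g ^ 2 • m) = g ^ 2 • e m := by
    intro g m
    rcases he g with h | h
    · rw [pow_two, mul_smul, mul_smul, h, h]
    · rw [pow_two, mul_smul, mul_smul, h, h, smul_neg, neg_neg]
  set X : AddSubgroup ↥(V.geomPrimaryTorsion p) := L.plus.comap e.toAddMonoidHom with hXdef
  have hmemX : ∀ m, m ∈ X ↔ e m ∈ L.plus := fun m ↦ by rw [hXdef, AddSubgroup.mem_comap]; rfl
  have hXdiv : ∀ m ∈ X, ∃ m' ∈ X, p • m' = m := by
    intro m hm
    obtain ⟨y, hy, hpy⟩ := hLdiv (e m) ((hmemX m).1 hm)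
    refine ⟨e.symm y, (hmemX _).2 (by rwa [AddEquiv.apply_symm_apply]), ?_⟩
    apply e.injective
    rw [map_nsmul, AddEquiv.apply_symm_apply, hpy]
  have hXtop : X ≠ ⊤ := by
    intro hX
    apply hLtop
    rw [eq_top_iff]
    intro y _
    have h : e.symm y ∈ X := by rw [hX]; exact AddSubgroup.mem_top _
    rw [hmemX, AddEquiv.apply_symm_apply] at h
    exact h
  have hXN : ∃ N₀ : ℕ, 0 < N₀ ∧ ∀ σ ∈ absInertia (v.adicCompletion ℚ),
      ∀ m : ↥(V.geomPrimaryTorsion p),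
        (absGaloisRestrict ℚ (v.adicCompletion ℚ) σ) ^ N₀ • m - m ∈ X := by
    refine ⟨2 * n, by omega, fun σ hσ m ↦ ?_⟩
    rw [hmemX, map_sub, mul_comm, pow_mul, hsq]
    set g := absGaloisRestrict ℚ (v.adicCompletion ℚ) σ ^ n with hg
    have h1 := hLn σ hσ (e m)
    have h2 := hLn σ hσ (g • e m)
    rw [← hg] at h1 h2
    have h := L.plus.add_mem h2 h1
    rw [sub_add_sub_cancel] at h
    rwa [pow_two, mul_smul]
  have hX := N.plus_eq_of_inertia_scalar hCdiv hCp hσ X hXdiv hXtop hXN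
  rw [← hX, hXdef, AddSubgroup.map_comap_eq_self_of_surjective]
  exact e.surjective

/-- **Any two ramified ordinary lines of such a transport coincide** (as local data).
[cite: GreenbergVatsal2000, §2 p. 26] [cite: GreenbergLNM1716, §2 p. 63] -/
theorem eq_of_isRamifiedOrdinaryLine_of_transport_of_inertia_scalar
    (hCdiv : ∀ c ∈ N.plus, ∃ c' ∈ N.plus, p • c' = c)
    (hCp : Nat.card ↥(N.plus ⊓ (↥(V.geomPrimaryTorsion p))[(p : ℤ)]) = p)
    (hσ : ∃ σ ∈ absInertia (v.adicCompletion ℚ), ∃ u : ℕ, 1 < u ∧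
      ∀ m ∈ N.plus, absGaloisRestrict ℚ (v.adicCompletion ℚ) σ • m = u • m)
    {W : WeierstrassCurve ℚ} (e : ↥(V.geomPrimaryTorsion p) ≃+ ↥(W.geomPrimaryTorsion p))
    (he : ∀ σ : absoluteGaloisGroup ℚ, (∀ m, e (σ • m) = σ • e m) ∨ (∀ m, e (σ • m) = -(σ • e m)))
    {L L' : LocalDatum ℚ ↥(W.geomPrimaryTorsion p) v} (hL : IsRamifiedOrdinaryLine W p L)
    (hL' : IsRamifiedOrdinaryLine W p L') : L = L' :=
  LocalDatum.eq_of_plus_eq (by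
    rw [N.plus_eq_map_of_isRamifiedOrdinaryLine_of_inertia_scalar hCdiv hCp hσ e he L hL,
      N.plus_eq_map_of_isRamifiedOrdinaryLine_of_inertia_scalar hCdiv hCp hσ e he L' hL'])

end Literature.NumberTheory.EllipticCurves.GreenbergSelmer.LocalDatum

namespace Summit.BirchSwinnertonDyer.Rank1Residual.AdditivePotMult

/-! ## §2. The Tate line carries the scalar `1 + p` -/

section Tate

variable (V : WeierstrassCurve ℚ) [V.IsGloballyMinimal] [V.IsElliptic] (p : ℕ) [hp : Fact p.Prime]
  {v : HeightOneSpectrum (𝓞 ℚ)}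

/-- **The Tate line with properties (a)(b)(c)** — `V` globally minimal, multiplicative at the odd `p`,
`v ∋ p`, granted A40/A41: a local datum `N` of `V[p^∞]` at `v` (p07's Tate line package) which is
`p`-divisible, has `#(N.plus ∩ V[p^∞][p]) = p`, and on which some local inertia element acts as
`1 + p` (`χ_p(σ₁) = 1 + p` by local Kronecker–Weber; the all-level clause of
`RamifiedOrdinaryLinePotMult.exists_tateDatum_package_all`). [cite: GreenbergVatsal2000, §2 pp. 14–15]
[cite: SilvermanATAEC1994, Ch. V Thm. 3.1 (c),(d), Thm. 5.3, Cor. 5.4] [cite: SerreLocalFields1979, Ch. IV §4 Prop. 17] -/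
theorem exists_tateLine_inertia_scalar (hT40 : Silverman1994_thmV53_tateUniformisation.{0})
    (hT41 : Silverman1994_thmV53_corV54_tateUniformisation.{0}) (hp2 : p ≠ 2)
    (hmult : V.HasMultiplicativeReductionAtPrime p) (hpv : ((p : ℕ) : 𝓞 ℚ) ∈ v.asIdeal) :
    ∃ N : LocalDatum ℚ (V.geomPrimaryTorsion p) v,
      (∀ c ∈ N.plus, ∃ c' ∈ N.plus, p • c' = c) ∧
      Nat.card ↥(N.plus ⊓ AddSubgroup.torsionBy (↥(V.geomPrimaryTorsion p)) (p : ℤ)) = p ∧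
      ∃ σ ∈ absInertia (v.adicCompletion ℚ), ∃ u : ℕ, 1 < u ∧
        ∀ m ∈ N.plus, absGaloisRestrict ℚ (v.adicCompletion ℚ) σ • m = u • m := by
  obtain ⟨N, -, hdiv, hcard, -, -, -, hall⟩ :=
    RamifiedOrdinaryLinePotMult.exists_tateDatum_package_all V p hT40 hT41 hp2 hmult hpv
  -- `σ₁` with `χ_p(σ₁) = 1 + p`
  have huunit : IsUnit (((1 + p : ℕ)) : ℤ_[p]) := by
    rw [PadicInt.isUnit_iff]
    refine le_antisymm (PadicInt.norm_le_one _) (not_lt.mp fun hlt ↦ ?_)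
    have hlt' : ‖((((1 + p : ℕ)) : ℤ) : ℤ_[p])‖ < 1 := by exact_mod_cast hlt
    have hdvd : (p : ℤ) ∣ (((1 + p : ℕ)) : ℤ) := (PadicInt.norm_int_lt_one_iff_dvd _).mp hlt'
    have hdvd' : p ∣ 1 + p := by exact_mod_cast hdvd
    exact hp.out.ne_one (Nat.dvd_one.mp ((Nat.dvd_add_right (dvd_refl p)).mp
      (by rwa [add_comm] at hdvd')))
  have hvp : (Rat.HeightOneSpectrum.primesEquiv v : ℕ) = p :=
    Rat.HeightOneSpectrum.primesEquiv_eq_of_natCast_mem v hp.out hpv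
  obtain ⟨σ₁, hσ₁I, hχ⟩ :=
    adicCompletion_rat_exists_mem_absInertia_cyclotomicCharacter_eq p v hvp huunit.unit
  refine ⟨N, hdiv, hcard, σ₁, hσ₁I, 1 + p, by have := hp.out.one_lt; omega, fun m hm ↦ ?_⟩
  exact hall σ₁ hσ₁I (1 + p) (by rw [hχ, IsUnit.unit_spec]) m hm

end Tate

/-! ## §3. Twist models of a multiplicative curve; the classes; the ∃-line adapters -/

section Models

variable (p : ℕ) [hp : Fact p.Prime] {v : HeightOneSpectrum (𝓞 ℚ)}

/-- **Uniqueness on a `ℚ`-model of a quadratic twist of a MULTIPLICATIVE curve** (mod A40/A41): `V`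
globally minimal, multiplicative at the odd `p`, `v ∋ p`, `d ≠ 0`, `W = C • V^{(d)}`: any two ramified
ordinary lines of `W` at `v` are equal. [cite: GreenbergVatsal2000, §2 pp. 14–15, 26] -/
theorem eq_of_isRamifiedOrdinaryLine_of_mult_model_twist
    (hT40 : Silverman1994_thmV53_tateUniformisation.{0})
    (hT41 : Silverman1994_thmV53_corV54_tateUniformisation.{0}) (hp2 : p ≠ 2)
    (V : WeierstrassCurve ℚ) [V.IsElliptic] [V.IsGloballyMinimal]
    (hmult : V.HasMultiplicativeReductionAtPrime p) (hpv : ((p : ℕ) : 𝓞 ℚ) ∈ v.asIdeal)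
    {d : ℚ} (hd : d ≠ 0) {W : WeierstrassCurve ℚ} (hCW : ∃ C : VariableChange ℚ, C • V.quadraticTwist d = W)
    {L L' : LocalDatum ℚ ↥(W.geomPrimaryTorsion p) v} (hL : IsRamifiedOrdinaryLine W p L)
    (hL' : IsRamifiedOrdinaryLine W p L') : L = L' := by
  haveI : NeZero (2 : ℚ) := ⟨two_ne_zero⟩
  obtain ⟨e, he, -, -⟩ := exists_addEquiv_geomPrimaryTorsion_of_model_twist_sign p V hd hCW
  obtain ⟨N, hdiv, hcard, hσ⟩ := exists_tateLine_inertia_scalar V p hT40 hT41 hp2 hmult hpv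
  exact N.eq_of_isRamifiedOrdinaryLine_of_transport_of_inertia_scalar hdiv hcard hσ e he hL hL'

variable {p} {W : WeierstrassCurve ℚ} [W.IsElliptic]

/-- **`PotMult W p`, `p` odd: the ramified ordinary line is UNIQUE** (mod A40/A41) — on the
multiplicative `p*`-twist model (`PotMult.exists_mult_pStar_twist_model`). Nothing booked.
[cite: GreenbergVatsal2000, §2 pp. 14–15, 26] -/
theorem PotMult.eq_of_isRamifiedOrdinaryLine (hT40 : Silverman1994_thmV53_tateUniformisation.{0})
    (hT41 : Silverman1994_thmV53_corV54_tateUniformisation.{0}) (hpm : PotMult W p) (hp2 : p ≠ 2)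
    (hv : ((p : ℕ) : 𝓞 ℚ) ∈ v.asIdeal)
    {L L' : LocalDatum ℚ ↥(W.geomPrimaryTorsion p) v} (hL : IsRamifiedOrdinaryLine W p L)
    (hL' : IsRamifiedOrdinaryLine W p L') : L = L' := by
  obtain ⟨V, _, _, C, hV, hC⟩ := hpm.exists_mult_pStar_twist_model hp2
  exact eq_of_isRamifiedOrdinaryLine_of_mult_model_twist p hT40 hT41 hp2 V hV hv
    (mul_ne_zero (pow_ne_zero _ (neg_ne_zero.mpr one_ne_zero)) (Nat.cast_ne_zero.mpr hp.out.ne_zero))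
    ⟨C, hC⟩ hL hL'

/-- **X4(M), every odd `p` (`p = 3` included): the ramified ordinary line is UNIQUE** (mod A40/A41);
it EXISTS by p07's `ClassX4M.exists_isRamifiedOrdinaryLine`. X4(M) stays as labelled; nothing booked.
[cite: GreenbergVatsal2000, §2 pp. 14–15, 26] -/
theorem ClassX4M.eq_of_isRamifiedOrdinaryLine (hT40 : Silverman1994_thmV53_tateUniformisation.{0})
    (hT41 : Silverman1994_thmV53_corV54_tateUniformisation.{0}) (hX : ClassX4M W p)
    (hv : ((p : ℕ) : 𝓞 ℚ) ∈ v.asIdeal)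
    {L L' : LocalDatum ℚ ↥(W.geomPrimaryTorsion p) v} (hL : IsRamifiedOrdinaryLine W p L)
    (hL' : IsRamifiedOrdinaryLine W p L') : L = L' :=
  (ClassX4M.potMult W p hX).eq_of_isRamifiedOrdinaryLine hT40 hT41 hX.p_ne_two hv hL hL'

/-- **X3♯(M), odd `p`: the ramified ordinary line is UNIQUE** (mod A40/A41); it EXISTS by p07's
`ClassX3M.exists_isRamifiedOrdinaryLine`. X3♯(M) stays as labelled; nothing booked.
[cite: GreenbergVatsal2000, §2 pp. 14–15, 26] -/
theorem ClassX3M.eq_of_isRamifiedOrdinaryLine [W.IsGloballyMinimal]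
    (hT40 : Silverman1994_thmV53_tateUniformisation.{0})
    (hT41 : Silverman1994_thmV53_corV54_tateUniformisation.{0}) (hX : ClassX3M W p)
    (hv : ((p : ℕ) : 𝓞 ℚ) ∈ v.asIdeal)
    {L L' : LocalDatum ℚ ↥(W.geomPrimaryTorsion p) v} (hL : IsRamifiedOrdinaryLine W p L)
    (hL' : IsRamifiedOrdinaryLine W p L') : L = L' :=
  (ClassX3M.potMult W p hX).eq_of_isRamifiedOrdinaryLine hT40 hT41 (ClassX3M.p_ne_two W p hX) hv hL hL'

/-- **`PotMult W p`: the δ-input `RamifiedLineKummerEqAt W p` from ONE line per `(κ, v)`** (mod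
A40/A41 through the uniqueness) — team n1011 row T-RD-M's literal ∃-statement feeds it by `exact`.
[cite: GreenbergVatsal2000, §2 p. 16 and p. 26] -/
theorem PotMult.ramifiedLineKummerEqAt_of_exists (hT40 : Silverman1994_thmV53_tateUniformisation.{0})
    (hT41 : Silverman1994_thmV53_corV54_tateUniformisation.{0}) (hpm : PotMult W p) (hp2 : p ≠ 2)
    (h : ∀ (κ : ZpExtension ℚ p), κ.IsCyclotomic →
      ∀ (v : HeightOneSpectrum (𝓞 ℚ)) (hv : ((p : ℕ) : 𝓞 ℚ) ∈ v.asIdeal),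
        ∃ L : LocalDatum ℚ (W.geomPrimaryTorsion p) v, IsRamifiedOrdinaryLine W p L ∧
          L.greenbergKer κ.kerSubgroup = W.localKerOver p κ.kerSubgroup (v.adicCompletion ℚ)) :
    RamifiedLineKummerEqAt W p :=
  ramifiedLineKummerEqAt_of_exists_of_plus_unique W p
    (fun _ hv _ _ hL hL' ↦ congrArg LocalDatum.plus
      (hpm.eq_of_isRamifiedOrdinaryLine hT40 hT41 hp2 hv hL hL')) h

/-- **X4(M): the δ-input from ONE line per `(κ, v)`** (mod A40/A41). [cite: GreenbergVatsal2000, §2 p. 16 and p. 26] -/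
theorem ClassX4M.ramifiedLineKummerEqAt_of_exists (hT40 : Silverman1994_thmV53_tateUniformisation.{0})
    (hT41 : Silverman1994_thmV53_corV54_tateUniformisation.{0}) (hX : ClassX4M W p)
    (h : ∀ (κ : ZpExtension ℚ p), κ.IsCyclotomic →
      ∀ (v : HeightOneSpectrum (𝓞 ℚ)) (hv : ((p : ℕ) : 𝓞 ℚ) ∈ v.asIdeal),
        ∃ L : LocalDatum ℚ (W.geomPrimaryTorsion p) v, IsRamifiedOrdinaryLine W p L ∧
          L.greenbergKer κ.kerSubgroup = W.localKerOver p κ.kerSubgroup (v.adicCompletion ℚ)) :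
    RamifiedLineKummerEqAt W p :=
  (ClassX4M.potMult W p hX).ramifiedLineKummerEqAt_of_exists hT40 hT41 hX.p_ne_two h

/-- **X3♯(M): the δ-input from ONE line per `(κ, v)`** (mod A40/A41). [cite: GreenbergVatsal2000, §2 p. 16 and p. 26] -/
theorem ClassX3M.ramifiedLineKummerEqAt_of_exists [W.IsGloballyMinimal]
    (hT40 : Silverman1994_thmV53_tateUniformisation.{0})
    (hT41 : Silverman1994_thmV53_corV54_tateUniformisation.{0}) (hX : ClassX3M W p)
    (h : ∀ (κ : ZpExtension ℚ p), κ.IsCyclotomic →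
      ∀ (v : HeightOneSpectrum (𝓞 ℚ)) (hv : ((p : ℕ) : 𝓞 ℚ) ∈ v.asIdeal),
        ∃ L : LocalDatum ℚ (W.geomPrimaryTorsion p) v, IsRamifiedOrdinaryLine W p L ∧
          L.greenbergKer κ.kerSubgroup = W.localKerOver p κ.kerSubgroup (v.adicCompletion ℚ)) :
    RamifiedLineKummerEqAt W p :=
  (ClassX3M.potMult W p hX).ramifiedLineKummerEqAt_of_exists hT40 hT41 (ClassX3M.p_ne_two W p hX) h

end Models

end Summit.BirchSwinnertonDyer.Rank1Residual.AdditivePotMult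

end
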